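import Literature.NumberTheory.Automorphic.SmoothInductionSphericalLine
import HarnessLib

/-!
# Non-vanishing of smooth induction: `Ind_H^G σ ≠ 0` as soon as `W^{H ∩ K′} ≠ 0` for some OPEN subgroup `K′`
(Bernstein–Zelevinsky, *Representations of GL(n, F)* (1976), §2.21–2.24; Bump (1997), §4.5; Cartier (Corvallis 1979), §III.3)

Topic `NumberTheory/Automorphic`; namespace `Representation` (dot-extensions of ★ `SmoothInduction`, as in ★ `SmoothInductionSphericalLine`).
THEOREMS ONLY (no definition, no instance, no named fact, no notation, no `sorry`).  Cell `hodgecm-mathlib`, FLOOR 0 ∕ P3 rung 4, row (G1-i)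
(F0P3-plan (g4) RULING (V25)(1), booked on B-p08 09:28Z): the generic half of «`i_B^G(χ) ≠ 0` for a continuous `χ`» — the input of the
𝔠₀ family of record at the finitely many non-split RAMIFIED places (hypothesis `hnt` of p01 (g7)'s `isXiLocalFamily_xiFamilyOfRecord`), where ★
`isSpherical_cmPrincipalSeries` (unramified `χ` only) does not apply.  `--supports stmt-HodgeConjecture-24833`; HC_CM is proved only modulo the
printed citations until rung 0 closes.

THE CONSTRUCTION ([BernsteinZelevinsky1976, §2.22–2.24]; the section «supported on one double coset»): for an OPEN subgroup `K′ ≤ G` and a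
vector `w ∈ W` fixed by `σ(H ∩ K′)`, the function `f(h κ) := σ(h) w` on `H·K′`, `f := 0` off `H·K′`, is well defined (★
`Representation.apply_eq_apply_of_mul_eq_mul`), `H`-equivariant, right-`K′`-invariant (hence SMOOTH, `K′` open), and `f(1) = w`.  This is ★
`SmoothInductionSphericalLine.exists_mem_fixedPoints_toFun_eq` WITHOUT its hypothesis `G = H·K` (there the section is everywhere `σ(h)w`; here
it is extended by zero).

* §1 `exists_mem_fixedPoints_toFun_eq_of_isOpen` — the section: `f ∈ (Ind_H^G σ)^{K′}`, `f(1) = w`, `f(h κ) = σ(h) w`, `f = 0` off `H·K′`.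
* §2 **`nontrivial_smoothInd_of_mem_fixedPoints_subgroupOf`** (`w ≠ 0` fixed by `H ∩ K′` ⇒ `Ind_H^G σ` non-trivial, indeed with a non-zero
  `K′`-FIXED vector: `exists_ne_zero_mem_fixedPoints_smoothIndRep`); **`nontrivial_smoothInd_of_forall_apply_eq_one`** — the character form:
  if `σ(h) = 1` for every `h ∈ H ∩ K′` (`K′` open) and `W ≠ 0`, then `Ind_H^G σ ≠ 0`.  For a one-dimensional CONTINUOUS `χ` on a subgroup of a
  non-archimedean group such a `K′` exists (★ `Literature.Topology.Algebra.exists_openSubgroup_trivialOn`, the circle has no small subgroups);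
  the CM instance for `i_G(χ_ξ)` is the sequel.

## Mathlib / tree search
★ `SmoothInduction` (`smoothInd`, `SmoothInd`, `indFun`, `mem_indFun_iff`, `isSmoothVector_of_le`, `SmoothInd.toFun`), ★ `SmoothInductionSphericalLine`
(`apply_eq_apply_of_mul_eq_mul`, `mem_fixedPoints_smoothIndRep_iff`), ★ `SmoothInductionParabolicNontrivial` (`nontrivial_smoothInd_standardParabolicGL`:
the `GL_n` open-cell section — parabolic-specific).  `lean search 'nontrivial_smoothInd|Nontrivial \(SmoothInd'`: only the `GL_n` one.
-/

set_option autoImplicit false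

noncomputable section

open MulAction

namespace Representation

variable {k G W : Type*} [CommRing k] [Group G] [TopologicalSpace G] [SeparatelyContinuousMul G] [AddCommGroup W] [Module k W]
  (H : Subgroup G) (σ : Representation k H W)

/-! ## §1 The section supported on `H · K′` -/

variable {H} in
/-- **The section supported on `H·K′`**: for an OPEN subgroup `K′ ≤ G` and `w ∈ W^{H ∩ K′}` there is `f ∈ (Ind_H^G σ)^{K′}` with `f(1) = w`,
`f(h κ) = σ(h) w` for `h ∈ H`, `κ ∈ K′`, and `f(g) = 0` for `g ∉ H·K′` — `H`-equivariant by ★ `apply_eq_apply_of_mul_eq_mul`, smooth because the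
open `K′` fixes it. [cite: BernsteinZelevinsky1976, §2.22] [cite: CartierCorvallis1979, §III.3] -/
theorem exists_mem_fixedPoints_toFun_eq_of_isOpen {K : Subgroup G} (hKo : IsOpen (K : Set G)) {w : W}
    (hw : w ∈ σ.fixedPoints (K.subgroupOf H)) :
    ∃ f : SmoothInd H σ, f ∈ (smoothIndRep H σ).fixedPoints K ∧ f.toFun 1 = w ∧
      (∀ (h : H) (κ : G), κ ∈ K → f.toFun (h * κ) = σ h w) ∧
        ∀ g : G, (∀ (h : H) (κ : G), κ ∈ K → g ≠ h * κ) → f.toFun g = 0 := by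
  classical
  -- the function: `σ(h) w` on `H·K`, `0` elsewhere
  let F : G → W := fun g => if hg : ∃ h : H, ∃ κ ∈ K, g = h * κ then σ hg.choose w else 0
  have hF_in : ∀ (g : G) (h : H) (κ : G), κ ∈ K → g = h * κ → F g = σ h w := fun g h κ hκ hg => by
    have hex : ∃ h : H, ∃ κ ∈ K, g = h * κ := ⟨h, κ, hκ, hg⟩
    simp only [F, dif_pos hex]
    obtain ⟨κ₀, hκ₀, hg₀⟩ := hex.choose_spec
    exact apply_eq_apply_of_mul_eq_mul σ hw hκ₀ hκ (hg₀.symm.trans hg)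
  have hF_out : ∀ g : G, (∀ (h : H) (κ : G), κ ∈ K → g ≠ h * κ) → F g = 0 := fun g hg => by
    have hne : ¬ ∃ h : H, ∃ κ ∈ K, g = h * κ := fun ⟨h, κ, hκ, e⟩ => hg h κ hκ e
    simp only [F, dif_neg hne]
  -- `H`-equivariance
  have hFmem : F ∈ coindV H.subtype σ := by
    rw [mem_indFun_iff]
    intro h g
    by_cases hg : ∃ h' : H, ∃ κ ∈ K, g = h' * κ
    · obtain ⟨h', κ, hκ, e⟩ := hg
      rw [hF_in g h' κ hκ e, hF_in (h * g) (h * h') κ hκ (by rw [Subgroup.coe_mul, mul_assoc, e]), map_mul,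
        Module.End.mul_apply]
    · have hg' : ∀ (h' : H) (κ : G), κ ∈ K → (h : G) * g ≠ h' * κ := fun h' κ hκ e =>
        hg ⟨h⁻¹ * h', κ, hκ, by rw [Subgroup.coe_mul, Subgroup.coe_inv, mul_assoc, ← e, inv_mul_cancel_left]⟩
      rw [hF_out _ hg', hF_out g fun h' κ hκ e => hg ⟨h', κ, hκ, e⟩, map_zero]
  -- right `K`-invariance
  have hFK : ∀ κ ∈ K, ∀ x : G, F (x * κ) = F x := fun κ hκ x => by
    by_cases hx : ∃ h : H, ∃ κ' ∈ K, x = h * κ'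
    · obtain ⟨h, κ', hκ', e⟩ := hx
      rw [hF_in x h κ' hκ' e, hF_in (x * κ) h (κ' * κ) (K.mul_mem hκ' hκ) (by rw [e, mul_assoc])]
    · have hx' : ∀ (h : H) (κ' : G), κ' ∈ K → x * κ ≠ h * κ' := fun h κ' hκ' e =>
        hx ⟨h, κ' * κ⁻¹, K.mul_mem hκ' (K.inv_mem hκ), by rw [← mul_assoc, ← e, mul_inv_cancel_right]⟩
      rw [hF_out _ hx', hF_out x fun h κ' hκ' e => hx ⟨h, κ', hκ', e⟩]
  -- smoothness: the stabiliser contains the open `K`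
  have hFsm : (indFun H σ).IsSmoothVector (⟨F, hFmem⟩ : coindV H.subtype σ) := by
    refine (indFun H σ).isSmoothVector_of_le hKo fun κ hκ => ?_
    rw [mem_stabilizerSubgroup]
    exact Subtype.ext (funext fun x => hFK κ hκ x)
  let f : SmoothInd H σ := (⟨⟨F, hFmem⟩, hFsm⟩ : ↥(smoothInd H σ).toSubmodule)
  have hftoFun : f.toFun = F := rfl
  refine ⟨f, (mem_fixedPoints_smoothIndRep_iff H K σ f).2 fun κ hκ x => by rw [hftoFun, hFK κ hκ x], ?_,
    fun h κ hκ => ?_, fun g hg => ?_⟩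
  · rw [hftoFun, hF_in 1 1 1 K.one_mem (by rw [Subgroup.coe_one, one_mul]), map_one, Module.End.one_apply]
  · rw [hftoFun]
    exact hF_in _ h κ hκ rfl
  · rw [hftoFun]
    exact hF_out g hg

/-! ## §2 Non-vanishing -/

variable {H} in
/-- The zero element of `Ind_H^G σ` is the zero function. [folklore] -/
private theorem SmoothInd.toFun_zero' : (0 : SmoothInd H σ).toFun = 0 := by
  have h := SmoothInd.toFun_smul (H := H) (σ := σ) (0 : k) 0
  rwa [zero_smul, zero_smul] at h

variable {H} in
/-- **A non-zero `K′`-fixed vector**: for `K′` open and `0 ≠ w ∈ W^{H ∩ K′}`, `Ind_H^G σ` has a non-zero `K′`-fixed vector (the section of §1,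
`f(1) = w ≠ 0`). [cite: BernsteinZelevinsky1976, §2.22–2.24] [cite: Bump1997, §4.5] -/
theorem exists_ne_zero_mem_fixedPoints_smoothIndRep {K : Subgroup G} (hKo : IsOpen (K : Set G)) {w : W}
    (hw : w ∈ σ.fixedPoints (K.subgroupOf H)) (hw0 : w ≠ 0) :
    ∃ f : SmoothInd H σ, f ≠ 0 ∧ f ∈ (smoothIndRep H σ).fixedPoints K := by
  obtain ⟨f, hfK, hf1, -, -⟩ := exists_mem_fixedPoints_toFun_eq_of_isOpen σ hKo hw
  refine ⟨f, fun h0 => hw0 ?_, hfK⟩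
  rw [← hf1, h0, SmoothInd.toFun_zero' σ, Pi.zero_apply]

variable {H} in
/-- **`Ind_H^G σ ≠ 0`** as soon as some OPEN subgroup `K′` has a non-zero `σ(H ∩ K′)`-fixed vector. [cite: BernsteinZelevinsky1976, §2.22–2.24] [cite: Bump1997, §4.5] -/
theorem nontrivial_smoothInd_of_mem_fixedPoints_subgroupOf {K : Subgroup G} (hKo : IsOpen (K : Set G)) {w : W}
    (hw : w ∈ σ.fixedPoints (K.subgroupOf H)) (hw0 : w ≠ 0) : Nontrivial (SmoothInd H σ) := by
  obtain ⟨f, hf0, -⟩ := exists_ne_zero_mem_fixedPoints_smoothIndRep σ hKo hw hw0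
  exact ⟨⟨f, 0, hf0⟩⟩

variable {H} in
/-- **`Ind_H^G σ ≠ 0` for an inducing representation killed by `H ∩ K′`, `K′` open** — the shape of an induced CHARACTER `χ` trivial on `H ∩ K′`
(for a continuous unitary `χ` such a `K′` exists in a non-archimedean group: ★ `Literature.Topology.Algebra.exists_openSubgroup_trivialOn`); every
`0 ≠ w ∈ W` serves. [cite: BernsteinZelevinsky1976, §2.22–2.24] [cite: Bump1997, §4.5] -/
theorem nontrivial_smoothInd_of_forall_apply_eq_one {K : Subgroup G} (hKo : IsOpen (K : Set G))
    (hσ : ∀ h : H, (h : G) ∈ K → σ h = 1) [Nontrivial W] : Nontrivial (SmoothInd H σ) := by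
  obtain ⟨w, hw0⟩ := exists_ne (0 : W)
  refine nontrivial_smoothInd_of_mem_fixedPoints_subgroupOf σ hKo ((σ.mem_fixedPoints _ w).2 fun h hh => ?_) hw0
  rw [hσ h (Subgroup.mem_subgroupOf.1 hh), Module.End.one_apply]

variable {H} in
/-- The same with a non-zero `K′`-fixed vector recorded (so that `(Ind_H^G σ)^{K′} ≠ 0` too). [cite: BernsteinZelevinsky1976, §2.22–2.24] -/
theorem exists_ne_zero_mem_fixedPoints_of_forall_apply_eq_one {K : Subgroup G} (hKo : IsOpen (K : Set G))
    (hσ : ∀ h : H, (h : G) ∈ K → σ h = 1) [Nontrivial W] :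
    ∃ f : SmoothInd H σ, f ≠ 0 ∧ f ∈ (smoothIndRep H σ).fixedPoints K := by
  obtain ⟨w, hw0⟩ := exists_ne (0 : W)
  refine exists_ne_zero_mem_fixedPoints_smoothIndRep σ hKo ((σ.mem_fixedPoints _ w).2 fun h hh => ?_) hw0
  rw [hσ h (Subgroup.mem_subgroupOf.1 hh), Module.End.one_apply]

end Representation

end
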